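import Summits.AtomisticToContinuum.FouriersLaw.Theses.KineticCorner
import Summits.AtomisticToContinuum.FouriersLaw.Theses.FourierGreenKubo
import HarnessLib

/-!
# `KineticCorner.Assembly` (stmt-AtomisticToContinuum-3437) — proved

Assembly item of route `KineticCorner` (sub-problem `FouriersLaw`):
`KineticCornerGreenKubo → KineticCornerComplement → NessUnique → FiniteResponseOfUnique → ThermodynamicLimit → FouriersLaw`.
Proof (the planner's sketch): clause (i) of the target `KineticCornerGreenKubo` (a Green–Kubo pair at every `T` below some
`T₀ > 0`) fed into `KineticCornerComplement` (upward continuation in temperature) gives a Green–Kubo pair at EVERY `T > 0`,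
i.e. the hypothesis `FourierGreenKubo` of the sibling route FourierGreenKubo; the remaining three hypotheses are the shared
items `NessUnique` (stmt-0741), `FiniteResponseOfUnique` (stmt-0717) and `ThermodynamicLimit` (stmt-0742), rendered with
identical bodies in both route files, so the sorry-free deciding theorem `Theses.FourierGreenKubo.closes` finishes.
Written by the lead of the sibling crux stmt-12594 (`MourreDissolution`) while parking that crux behind this route's target
(bridge `Theorems.MourreDissolution.mourreDissolution_of_kineticCornerGreenKubo`).
-/

namespace Summit.AtomisticToContinuum.FouriersLaw.Theorems.KineticCorner

/-- **Assembly of route `KineticCorner`** (stmt-AtomisticToContinuum-3437):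
`KineticCornerGreenKubo → KineticCornerComplement → NessUnique → FiniteResponseOfUnique → ThermodynamicLimit → FouriersLaw`.
Target clause (i) + Complement = `FourierGreenKubo.FourierGreenKubo`; then `Theses.FourierGreenKubo.closes`. [folklore] -/
theorem assembly_proof : Summit.AtomisticToContinuum.FouriersLaw.Theses.KineticCorner.Assembly := by
  unfold Summit.AtomisticToContinuum.FouriersLaw.Theses.KineticCorner.Assembly
  intro hT hC hNU hFR hTL
  have hGK : Summit.AtomisticToContinuum.FouriersLaw.Theses.FourierGreenKubo.FourierGreenKubo := by
    intro ω₂ lam β γ hω hl hβ hγ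
    obtain ⟨c, T₀, _, hT₀, hi, -⟩ := hT ω₂ lam β γ hω hl hβ hγ
    exact hC ω₂ lam β γ hω hl hβ hγ T₀ hT₀ hi
  exact Summit.AtomisticToContinuum.FouriersLaw.Theses.FourierGreenKubo.closes hGK hNU hFR hTL

end Summit.AtomisticToContinuum.FouriersLaw.Theorems.KineticCorner
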